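import Literature.RepresentationTheory.Ichino2022.FockKTypeCorrespondence

/-!
# Konno–Konno 2007, §5.2 Lemma 5.3 / Thm 5.4 at the signature `U(2,1) × U(1,1)` (a PLANE of signature `(1,1)` against
# `U(2,1)`): the explicit polynomial Fock model `ℂ[z_a, w, y_a, v]`, its joint harmonics (all four families of (5.1)),
# the highest-weight vectors `Δ_{abcd}`, and Ichino's Lemma 7.10 dictionary over it (checked skeleton; sibling file
# `…JointHarmonicsPosPlane` treats `U(2,1) × U(2,0)`)

Source: T. Konno, K. Konno, *On doubling construction for real unitary dual pairs*, Kyushu J. Math. **61** (2007)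
35–82, doi:10.2206/kyushujm.61.35 — bib key `KonnoKonno2007`; held as [corpus: paper:doi-10-2206-kyushujm-61-35]
(`pNNNN.txt`, journal page = PDF page + 34; prose legible, displayed weight formulae column-scrambled and therefore
READ, not quoted — the extraction caveat K-1 recorded in `…KonnoKonno2007.FockModelUnitaryDualPair` §3).  The
`K × K′`-dictionary is A. Ichino, Adv. Math. **398** (2022) 108188 §7.5 Lemma 7.10 [Ichino2022ThetaReal], whose
printed proof is "Given our choice of the datum `(χ_V, χ_W, ψ)`, the assertion follows from [Konno–Konno 2007]"
(`…Ichino2022.FockKTypeCorrespondence`, [corpus: paper:arxiv-2008.06174 p0020 L9–22]).  The verbatim pack (§5.1 (5.1),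
Fact 5.1, §5.2, Lemma 5.3, Thm 5.4 with page/line locators) is in the module docstring of `…JointHarmonicsPosPlane` and
is not repeated; the items used here:

* §5.1 p. 71 L5–7 (p0037): "*Their intersection `J_{V,W,ξ} := H_V(K_W) ∩ H_W(K_V)` is called the space of joint
  harmonics. Propositions 4.4(ii) and (iii) for `(V, W±)`, `(V±, W)` in place of `(V, W)` show that `J_{V,W,ξ}`
  consists of `P ∈ P_{V,W,ξ}` killed by*" (5.1): the FOUR families `Σ_{ℓ∈W⁺} ∂²/∂w_{j,ℓ}∂w_{p+k,ℓ}`,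
  `Σ_{ℓ∈W⁻} ∂²/∂w_{j,ℓ}∂w_{p+k,ℓ}` (`j ∈ V⁺`, `k ∈ V⁻`), `Σ_{ℓ∈V⁺} ∂²/∂w_{ℓ,j}∂w_{ℓ,p′+k}`, `Σ_{ℓ∈V⁻} ∂²/∂w_{ℓ,j}∂w_{ℓ,p′+k}`
  (`j ∈ W⁺`, `k ∈ W⁻`) — ALL non-empty when both `V` and `W` are indefinite;
* p. 73 L153–158 (p0039): "*`Δ_{abcd}(w_{j,k}) := Δ_a(w_{j,k}) Δ⁻_b(w_{j,p′+k}) Δ_c(w_{p+j,k}) Δ_d(w_{p+j,p′+k})`*", lengths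
  `r ≤ min(p,p′)`, `s ≤ min(p,q′)`, `t ≤ min(q,p′)`, `u ≤ min(q,q′)`;
* **Lemma 5.3** p. 74 (p0040 L17–52): (i) `Δ_{abcd}` is a highest weight vector with the displayed weights; "*(ii) `Δ_{abcd}`
  belongs to `J_{V,W,ξ}` if and only if `r + s ≤ p`, `t + u ≤ q`, `r + t ≤ p′`, `s + u ≤ q′`. (iii) Any `b̄_V ⊕ b_W`-highest
  weight vector in the `k_{V,ℂ} ⊕ k_{W,ℂ}`-module `J_{V,W,ξ}` is of the form `Δ_{abcd}`.*" (proof of (iii): "*in the same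
  way as in [KV78, Proposition III 6.1]. We omit the details.*", p0041 L30–31);
* **Theorem 5.4** p. 75 (p0041 L38–100): the `K`-type correspondence read off Lemma 5.3.

## What this file does

Tree conventions as in the sibling file (`𝕎 = V ⊗ W` with the block datum `dualPairι`: standard Kronecker action of
`K_V × K_W` on the same-sign blocks `V⁺⊗W⁺`, `V⁻⊗W⁻`, conjugate on the mixed blocks `V⁺⊗W⁻`, `V⁻⊗W⁺`; polynomial
torus weights `+1` per degree on the same-sign blocks, `−1` on the mixed ones; highest weights w.r.t. upper-triangular
Borels).  Here `G_V = U(2,1)` (`V⁺ = ℂ²`, rows `a ∈ Fin 2`; `V⁻ = ℂ`) and `W = W⁺ ⊕ W⁻` a plane of signature `(1,1)`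
(Ichino `(p,q;r,s) = (1,1;2,1)`), namespace `MixedPlane`:

* §B.1–B.2: the model `ℂ[z_a, w, y_a, v]` on the four blocks `V⁺⊗W⁺` (`z_a`), `V⁻⊗W⁺` (`w`), `V⁺⊗W⁻` (`y_a`), `V⁻⊗W⁻`
  (`v`); the five torus weights (`U(W⁺)`: `z ↦ +1, w ↦ −1`; `U(W⁻)`: `v ↦ +1, y ↦ −1`; `U(2)_V` rows: `z_a ↦ +1, y_a ↦ −1`;
  `U(V⁻)`: `v ↦ +1, w ↦ −1`); the four families of (5.1): `Δ⁺_a = ∂_{z_a}∂_w`, `Δ⁻_a = ∂_{y_a}∂_v` (`a ∈ Fin 2`),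
  `D₊ = Σ_a ∂_{z_a}∂_{y_a}`, `D₋ = ∂_v∂_w`; the raising operator `E_V = z_0∂_{z_1} − y_1∂_{y_0}` of `𝔲(2)_V` (standard on
  `z`, conjugate on `y`; `K_W = U(1) × U(1)` has no roots); the predicate `IsHWVector`;
* §B.3: the vectors `Δ_{abcd}` of this signature, `kkVec i j k l = z_0^i · w^j · v^k · y_1^l` (`a = (i)` on `V⁺⊗W⁺`,
  `c = (j)` on `V⁻⊗W⁺`, `d = (k)` on `V⁻⊗W⁻`, `b = (l)` on `V⁺⊗W⁻` — the trailing entry `y_1`, highest for the conjugate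
  row action); PROVED: Lemma 5.3 (i)–(ii) for them — `isHWVector_kkVec` (weights `U(W⁺)`: `i−j`, `U(W⁻)`: `k−l`,
  `U(2)_V`: `(i, −l)`, `U(V⁻)`: `k−j`) under the three non-vacuous constraints of (ii), `t+u ≤ q = 1` (`j = 0 ∨ k = 0`),
  `r+t ≤ p′ = 1` (`i = 0 ∨ j = 0`), `s+u ≤ q′ = 1` (`l = 0 ∨ k = 0`), each shown sharp
  (`not_isHarmonic_w_mul_v`, `not_isHarmonic_z_mul_w`, `not_isHarmonic_y_mul_v`);
* §B.4: the `FockHarmonics` dictionary `explicitMixedPlane` of `…Ichino2022.FockKTypeCorrespondence` over the model,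
  the PROVED half of Lemma 7.10 / Thm 5.4 (ii) (`corresponds_mu_mu'`: every printed parameter is realised by a `kkVec`),
  and the REDUCTION of the full lemma to Lemma 5.3 (iii) at this signature (`lemma_7_10_of_classification`).

Nothing is asserted: every `def` has a body, every theorem is proved; no `def … : Prop` record is introduced.  The
identification with the `K × K′`-finite vectors of a constructed archimedean Weil datum of `U(2,1) × U(1,1)` is NOT made
here (the tree has no such datum yet: both factors of positive real rank, cf. the scope note of
`Literature.NumberTheory.Weil1964.ArchDualPairThetaMajorants`).

## References

* [KonnoKonno2007] T. Konno, K. Konno, Kyushu J. Math. 61 (2007) 35–82, §5.1 (5.1), Fact 5.1, §5.2 Lemma 5.3, Thm 5.4.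
* [Ichino2022ThetaReal] A. Ichino, Adv. Math. 398 (2022) 108188, §4.1, §7.5 Lemma 7.10.
* [KashiwaraVergne1978] M. Kashiwara, M. Vergne, Invent. Math. 44 (1978) 1–47, Ch. III §5 (5.1), Prop. 6.1.
* [Howe1989Transcending] R. Howe, J. AMS 2 (1989) 535–552, §3 (joint harmonics; cited by KK07 as [How89]).

Provenance: pub-hodgecm2 literature fan-out row B09-1 (typer seat `literature-prover-pub-hodgecm2-t-b09-1`).
-/

namespace Literature.RepresentationTheory.KonnoKonno2007

open MvPolynomial Finsupp
open Literature.RepresentationTheory.Ichino2022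

noncomputable section

/-! ## §0 Generic tools on polynomial rings (file-private) -/

section Tools

variable {σ : Type*}

/-- Partial derivatives of polynomials commute. [folklore] -/
private theorem pderiv_pderiv_comm' (i j : σ) (p : MvPolynomial σ ℂ) :
    pderiv i (pderiv j p) = pderiv j (pderiv i p) := by
  classical
  induction p using MvPolynomial.induction_on with
  | C a => simp only [pderiv_C, map_zero]
  | add p q hp hq => simp only [map_add, hp, hq]
  | mul_X p k hp =>
    simp only [pderiv_mul, map_add, hp, pderiv_X]
    by_cases hik : i = k <;> by_cases hjk : j = k <;> simp [hik, hjk, eq_comm]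

/-- A second-order operator `∂_i ∂_j` kills a polynomial in which `j` does not occur. [folklore] -/
private theorem pderiv_pderiv_eq_zero_of_notMem_right (i j : σ) {p : MvPolynomial σ ℂ} (h : j ∉ p.vars) :
    pderiv i (pderiv j p) = 0 := by
  rw [pderiv_eq_zero_of_notMem_vars h, map_zero]

/-- A second-order operator `∂_i ∂_j` kills a polynomial in which `i` does not occur. [folklore] -/
private theorem pderiv_pderiv_eq_zero_of_notMem_left (i j : σ) {p : MvPolynomial σ ℂ} (h : i ∉ p.vars) :
    pderiv i (pderiv j p) = 0 := by
  rw [pderiv_pderiv_comm', pderiv_eq_zero_of_notMem_vars h, map_zero]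

/-- `vars (X i ^ n) ⊆ {i}`. [folklore] -/
private theorem vars_X_pow_subset (i : σ) (n : ℕ) : ((X i : MvPolynomial σ ℂ) ^ n).vars ⊆ {i} := by
  classical
  refine (vars_pow _ _).trans ?_
  rw [vars_X]

/-- The head entry of an integer string, `0` for the empty string. [folklore] -/
private def headD {k : ℕ} (x : Fin k → ℤ) : ℤ := if h : 0 < k then x ⟨0, h⟩ else 0

/-- [folklore] -/
private theorem headD_of_pos {k : ℕ} (x : Fin k → ℤ) (h : 0 < k) : headD x = x ⟨0, h⟩ := dif_pos h

/-- [folklore] -/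
private theorem headD_of_not {k : ℕ} (x : Fin k → ℤ) (h : ¬ 0 < k) : headD x = 0 := dif_neg h

/-- The head of the constant string of length `min n 1` with value `z`, where `z = 0` if `n = 0`, is `z`. [folklore] -/
private theorem headD_const_min (n : ℕ) (z : ℤ) (hz : n = 0 → z = 0) :
    headD (fun _ : Fin (min n 1) => z) = z := by
  unfold headD
  split_ifs with h
  · rfl
  · exact (hz (by omega)).symm

/-- Ichino's block vector of length `1` with strings of lengths `k + l ≤ 1`: its only entry is `head x + head y`
(at most one of the two strings is non-empty). [cite: Ichino2022ThetaReal, §7.5 Lemma 7.10] -/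
private theorem pad_eq_headD_of_eq_one {N k l : ℕ} (hN : N = 1) (h : k + l ≤ N) (x : Fin k → ℤ) (y : Fin l → ℤ)
    (i : Fin N) : pad N k l h x y i = (headD x : ℚ) + headD y := by
  subst hN
  have hi : i = ⟨0, by omega⟩ := Fin.ext (by have := i.isLt; omega)
  subst hi
  by_cases hk : 0 < k
  · have hl : ¬ 0 < l := by omega
    rw [pad_head _ _ _ _ (by simpa using hk), headD_of_pos _ hk, headD_of_not _ hl]
    simp
  · by_cases hl : 0 < l
    · rw [pad_tail _ _ _ _ (by simp; omega) (by simp; omega), headD_of_not _ hk, headD_of_pos _ hl]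
      have : y ⟨(⟨0, by omega⟩ : Fin 1).val - (1 - l), by simp; omega⟩ = y ⟨0, hl⟩ := by
        congr 1; exact Fin.ext (by simp)
      rw [this]; simp
    · rw [pad_mid _ _ _ _ (by simp; omega) (by simp; omega), headD_of_not _ hk, headD_of_not _ hl]
      simp

/-- Ichino's block vector of length `2` with strings of lengths `k ≤ 1`, `l ≤ 1`: entry `0` is `head x`.
[cite: Ichino2022ThetaReal, §7.5 Lemma 7.10] -/
private theorem pad_fst_eq_headD_of_eq_two {N k l : ℕ} (hN : N = 2) (h : k + l ≤ N) (hk : k ≤ 1) (hl : l ≤ 1)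
    (x : Fin k → ℤ) (y : Fin l → ℤ) : pad N k l h x y ⟨0, by omega⟩ = (headD x : ℚ) := by
  subst hN
  by_cases hk0 : 0 < k
  · rw [pad_head _ _ _ _ (by simpa using hk0), headD_of_pos _ hk0]
  · rw [pad_mid _ _ _ _ (by simp; omega) (by simp; omega), headD_of_not _ hk0]
    simp

/-- Ichino's block vector of length `2` with strings of lengths `k ≤ 1`, `l ≤ 1`: entry `1` is `head y`.
[cite: Ichino2022ThetaReal, §7.5 Lemma 7.10] -/
private theorem pad_snd_eq_headD_of_eq_two {N k l : ℕ} (hN : N = 2) (h : k + l ≤ N) (hk : k ≤ 1) (hl : l ≤ 1)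
    (x : Fin k → ℤ) (y : Fin l → ℤ) : pad N k l h x y ⟨1, by omega⟩ = (headD y : ℚ) := by
  subst hN
  by_cases hl0 : 0 < l
  · rw [pad_tail _ _ _ _ (by simp; omega) (by simp; omega), headD_of_pos _ hl0]
    have : y ⟨(⟨1, by omega⟩ : Fin 2).val - (2 - l), by simp; omega⟩ = y ⟨0, hl0⟩ := by
      congr 1; exact Fin.ext (by simp; omega)
    rw [this]
  · rw [pad_mid _ _ _ _ (by simp; omega) (by simp; omega), headD_of_not _ hl0]
    simp

end Tools

/-! ## Part B.  `W` of signature `(1,1)`: the model `ℂ[z_a, w, y_a, v]` of `U(2,1) × U(1,1)` (Ichino `(1,1;2,1)`) -/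

namespace MixedPlane

/-- Variables of the Fock model of `U(2,1) × U(1,1)`: a pair (`V`-index, `W`-column) with `V`-index `inl a` (`a ∈ Fin 2`,
a row of `V⁺`) or `inr ()` (`V⁻`) and `W`-column `0 = W⁺`, `1 = W⁻`; so `(inl a, 0) = z_a` (`V⁺⊗W⁺`, same-sign),
`(inr (), 0) = w` (`V⁻⊗W⁺`, mixed), `(inl a, 1) = y_a` (`V⁺⊗W⁻`, mixed), `(inr (), 1) = v` (`V⁻⊗W⁻`, same-sign).
[cite: KonnoKonno2007, §5.2 p. 73] -/
abbrev Var : Type := (Fin 2 ⊕ Unit) × Fin 2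

/-- The explicit Fock model `ℂ[z_0, z_1, w, y_0, y_1, v]` of `U(2,1) × U(1,1)`. [cite: KonnoKonno2007, Prop 4.4 (i) p. 68] -/
abbrev Model : Type := MvPolynomial Var ℂ

/-- `z_a`. [cite: KonnoKonno2007, §5.2 p. 73] -/
abbrev z (a : Fin 2) : Model := X (Sum.inl a, 0)
/-- `w`. [cite: KonnoKonno2007, §5.2 p. 73] -/
abbrev w : Model := X (Sum.inr (), 0)
/-- `y_a`. [cite: KonnoKonno2007, §5.2 p. 73] -/
abbrev y (a : Fin 2) : Model := X (Sum.inl a, 1)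
/-- `v`. [cite: KonnoKonno2007, §5.2 p. 73] -/
abbrev v : Model := X (Sum.inr (), 1)

/-! ### B.1 Torus weights (tree convention: `+1` per degree on the same-sign blocks, `−1` on the mixed blocks) -/

/-- `U(W⁺)`-weight: `z_a ↦ +1`, `w ↦ −1`, the `W⁻`-column `↦ 0`. [cite: KonnoKonno2007, Lemma 5.2 p. 73] -/
def colP : Var → ℤ
  | (Sum.inl _, c) => if c = 0 then 1 else 0
  | (Sum.inr _, c) => if c = 0 then -1 else 0

/-- `U(W⁻)`-weight: `v ↦ +1`, `y_a ↦ −1`, the `W⁺`-column `↦ 0`. [cite: KonnoKonno2007, Lemma 5.2 p. 73] -/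
def colM : Var → ℤ
  | (Sum.inl _, c) => if c = 0 then 0 else -1
  | (Sum.inr _, c) => if c = 0 then 0 else 1

/-- `U(2)_V`-torus (row) weight: `z_a ↦ +1`, `y_a ↦ −1` (row `a`), `w, v ↦ 0`. [cite: KonnoKonno2007, Lemma 5.2 p. 73] -/
def rowW (a : Fin 2) : Var → ℤ
  | (Sum.inl a', c) => if a' = a then (if c = 0 then 1 else -1) else 0
  | (Sum.inr _, _) => 0

/-- `U(V⁻)`-weight: `v ↦ +1`, `w ↦ −1`, `z, y ↦ 0` (relative to the vacuum). [cite: KonnoKonno2007, Lemma 5.2 p. 73] -/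
def uOneV : Var → ℤ
  | (Sum.inl _, _) => 0
  | (Sum.inr _, c) => if c = 0 then -1 else 1

/-! ### B.2 The operators: the four families of (5.1), the raising operator of `𝔲(2)_V` -/

/-- **`Δ⁺_a = ∂_{z_a} ∂_w`** (`a ∈ Fin 2`): a `V⁺`-row against the `V⁻`-row along the `W⁺`-column.
[cite: KonnoKonno2007, §5.1 (5.1) p. 71] -/
def DeltaP (a : Fin 2) : Model →ₗ[ℂ] Model :=
  (pderiv (Sum.inl a, (0 : Fin 2))).toLinearMap ∘ₗ (pderiv (Sum.inr (), (0 : Fin 2))).toLinearMap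

/-- **`Δ⁻_a = ∂_{y_a} ∂_v`** (`a ∈ Fin 2`): a `V⁺`-row against the `V⁻`-row along the `W⁻`-column.
[cite: KonnoKonno2007, §5.1 (5.1) p. 71] -/
def DeltaM (a : Fin 2) : Model →ₗ[ℂ] Model :=
  (pderiv (Sum.inl a, (1 : Fin 2))).toLinearMap ∘ₗ (pderiv (Sum.inr (), (1 : Fin 2))).toLinearMap

/-- **`D₊ = Σ_a ∂_{z_a} ∂_{y_a}`**: the `W⁺`-column against the `W⁻`-column along the `V⁺`-rows.
[cite: KonnoKonno2007, §5.1 (5.1) p. 71] -/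
def Dplus : Model →ₗ[ℂ] Model :=
  ∑ a : Fin 2, (pderiv (Sum.inl a, (0 : Fin 2))).toLinearMap ∘ₗ (pderiv (Sum.inl a, (1 : Fin 2))).toLinearMap

/-- **`D₋ = ∂_v ∂_w`**: the `W⁺`-column against the `W⁻`-column along the `V⁻`-row. [cite: KonnoKonno2007, §5.1 (5.1) p. 71] -/
def Dminus : Model →ₗ[ℂ] Model :=
  (pderiv (Sum.inr (), (1 : Fin 2))).toLinearMap ∘ₗ (pderiv (Sum.inr (), (0 : Fin 2))).toLinearMap

/-- [cite: KonnoKonno2007, §5.1 (5.1) p. 71] -/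
theorem DeltaP_apply (a : Fin 2) (f : Model) : DeltaP a f = pderiv (Sum.inl a, 0) (pderiv (Sum.inr (), 0) f) := rfl

/-- [cite: KonnoKonno2007, §5.1 (5.1) p. 71] -/
theorem DeltaM_apply (a : Fin 2) (f : Model) : DeltaM a f = pderiv (Sum.inl a, 1) (pderiv (Sum.inr (), 1) f) := rfl

/-- [cite: KonnoKonno2007, §5.1 (5.1) p. 71] -/
theorem Dplus_apply (f : Model) : Dplus f = ∑ a : Fin 2, pderiv (Sum.inl a, 0) (pderiv (Sum.inl a, 1) f) := by
  simp [Dplus]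

/-- [cite: KonnoKonno2007, §5.1 (5.1) p. 71] -/
theorem Dminus_apply (f : Model) : Dminus f = pderiv (Sum.inr (), 1) (pderiv (Sum.inr (), 0) f) := rfl

/-- Generator images of the raising operator of `𝔲(2)_V`: `z_1 ↦ z_0` (standard on the same-sign block), `y_0 ↦ −y_1`
(conjugate on the mixed block), else `0`. [folklore] -/
def evGen : Var → Model
  | (Sum.inl a, c) => if c = 0 then (if a = 1 then z 0 else 0) else (if a = 0 then -y 1 else 0)
  | (Sum.inr _, _) => 0

/-- **`E_V = z_0 ∂_{z_1} − y_1 ∂_{y_0}`**, the raising operator `e_{01}` of `𝔲(2)_V ⊗ ℂ`, as a derivation.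
[cite: KonnoKonno2007, §5.2 (5.3) p. 72] -/
def EV : Derivation ℂ Model Model := mkDerivation ℂ evGen

/-- unfolding `E_V` on a variable. [cite: KonnoKonno2007, §5.2 (5.3) p. 72] -/
@[simp] theorem EV_X (u : Var) : EV (X u) = evGen u := mkDerivation_X _ _ _

/-- **The joint harmonics** of the model: killed by all four families of (5.1). [cite: KonnoKonno2007, §5.1 (5.1) p. 71] -/
structure IsHarmonic (f : Model) : Prop where
  /-- `Δ⁺_a f = 0` -/
  deltaP : ∀ a : Fin 2, DeltaP a f = 0
  /-- `Δ⁻_a f = 0` -/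
  deltaM : ∀ a : Fin 2, DeltaM a f = 0
  /-- `D₊ f = 0` -/
  dplus : Dplus f = 0
  /-- `D₋ f = 0` -/
  dminus : Dminus f = 0

/-- **A joint `K_V × K_W`-highest-weight vector in the joint harmonics** with `U(W⁺)`-weight `kP`, `U(W⁻)`-weight `kM`,
`U(2)_V`-weight `(n₀, n₁)` and `U(V⁻)`-weight `nv`: non-zero, harmonic, a weight vector of the five circles, killed by `E_V`
(`K_W` is a torus: no further raising operator). [cite: KonnoKonno2007, Lemma 5.3 p. 74] -/
structure IsHWVector (f : Model) (kP kM n₀ n₁ nv : ℤ) : Prop where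
  /-- non-zero -/
  ne : f ≠ 0
  /-- joint harmonic -/
  harm : IsHarmonic f
  /-- `U(W⁺)`-weight -/
  colP : IsWeightedHomogeneous colP f kP
  /-- `U(W⁻)`-weight -/
  colM : IsWeightedHomogeneous colM f kM
  /-- `U(2)_V`-weight, row `0` -/
  row0 : IsWeightedHomogeneous (rowW 0) f n₀
  /-- `U(2)_V`-weight, row `1` -/
  row1 : IsWeightedHomogeneous (rowW 1) f n₁
  /-- `U(V⁻)`-weight -/
  uone : IsWeightedHomogeneous uOneV f nv
  /-- killed by the raising operator of `𝔲(2)_V` -/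
  hV : EV f = 0

/-! ### B.3 The vectors `Δ_{abcd}` of this signature and Lemma 5.3 (i)–(ii) for them -/

/-- **`Δ_{abcd}` at `U(2,1) × U(1,1)`**: `kkVec i j k l = z_0^i · w^j · v^k · y_1^l` — one power of one entry per block
(`a = (i)` on `V⁺⊗W⁺`: `z_0`; `c = (j)` on `V⁻⊗W⁺`: `w`; `d = (k)` on `V⁻⊗W⁻`: `v`; `b = (l)` on `V⁺⊗W⁻`: the entry `y_1`,
highest for the conjugate action of `U(2)_V` on that block). [cite: KonnoKonno2007, §5.2 p. 73] -/
def kkVec (i j k l : ℕ) : Model := z 0 ^ i * w ^ j * v ^ k * y 1 ^ l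

/-- the variables of `kkVec i j k l` are among `z_0, w, v, y_1`, and an entry with exponent `0` does not occur. [folklore] -/
private theorem vars_kkVec_subset (i j k l : ℕ) :
    (kkVec i j k l).vars ⊆
      (if i = 0 then ∅ else {(Sum.inl 0, 0)}) ∪ (if j = 0 then ∅ else {(Sum.inr (), 0)}) ∪
        (if k = 0 then ∅ else {(Sum.inr (), 1)}) ∪ (if l = 0 then ∅ else {(Sum.inl 1, 1)}) := by
  classical
  have hX : ∀ (u : Var) (n : ℕ), ((X u : Model) ^ n).vars ⊆ (if n = 0 then ∅ else {u}) := by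
    intro u n
    split_ifs with hn
    · subst hn; simp
    · exact vars_X_pow_subset u n
  unfold kkVec
  refine (vars_mul _ _).trans (Finset.union_subset_union ((vars_mul _ _).trans
    (Finset.union_subset_union ((vars_mul _ _).trans (Finset.union_subset_union (hX _ _) (hX _ _))) (hX _ _)))
    (hX _ _))

/-- membership test used below: a variable outside the four possible ones, or with vanishing exponent, is absent. [folklore] -/
private theorem notMem_vars_kkVec {i j k l : ℕ} {u : Var}
    (h : u ∉ (if i = 0 then ∅ else {(Sum.inl 0, 0)}) ∪ (if j = 0 then ∅ else {(Sum.inr (), 0)}) ∪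
        (if k = 0 then ∅ else {(Sum.inr (), 1)}) ∪ (if l = 0 then (∅ : Finset Var) else {(Sum.inl 1, 1)})) :
    u ∉ (kkVec i j k l).vars := fun hu => h (vars_kkVec_subset i j k l hu)

/-- **Lemma 5.3 (ii), the harmonic half, at `U(2,1) × U(1,1)`**: under `t + u ≤ q` (`j = 0 ∨ k = 0`), `r + t ≤ p′`
(`i = 0 ∨ j = 0`) and `s + u ≤ q′` (`l = 0 ∨ k = 0`) the vector `z_0^i w^j v^k y_1^l` is a joint harmonic.
[cite: KonnoKonno2007, Lemma 5.3 (ii) p. 74] -/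
theorem isHarmonic_kkVec (i j k l : ℕ) (hjk : j = 0 ∨ k = 0) (hij : i = 0 ∨ j = 0) (hlk : l = 0 ∨ k = 0) :
    IsHarmonic (kkVec i j k l) := by
  classical
  refine ⟨fun a => ?_, fun a => ?_, ?_, ?_⟩
  · -- `Δ⁺_a = ∂_{z_a}∂_w`: no `w` (`j = 0`), or no `z` at all (`i = 0`; `z_1` never occurs)
    rw [DeltaP_apply]
    rcases hij with hi | hj
    · refine pderiv_pderiv_eq_zero_of_notMem_left _ _ (notMem_vars_kkVec ?_)
      subst hi; fin_cases a <;> simp <;> split_ifs <;> simp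
    · refine pderiv_pderiv_eq_zero_of_notMem_right _ _ (notMem_vars_kkVec ?_)
      subst hj; simp; split_ifs <;> simp
  · -- `Δ⁻_a = ∂_{y_a}∂_v`: no `v` (`k = 0`), or no `y` at all (`l = 0`; `y_0` never occurs)
    rw [DeltaM_apply]
    rcases hlk with hl | hk
    · refine pderiv_pderiv_eq_zero_of_notMem_left _ _ (notMem_vars_kkVec ?_)
      subst hl; fin_cases a <;> simp <;> split_ifs <;> simp
    · refine pderiv_pderiv_eq_zero_of_notMem_right _ _ (notMem_vars_kkVec ?_)
      subst hk; simp; split_ifs <;> simp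
  · -- `D₊ = ∂_{z_0}∂_{y_0} + ∂_{z_1}∂_{y_1}`: `y_0` and `z_1` never occur
    rw [Dplus_apply, Fin.sum_univ_two]
    rw [pderiv_pderiv_eq_zero_of_notMem_right _ _ (notMem_vars_kkVec (by simp; split_ifs <;> simp)),
      pderiv_pderiv_eq_zero_of_notMem_left _ _ (notMem_vars_kkVec (by simp; split_ifs <;> simp)), add_zero]
  · -- `D₋ = ∂_v∂_w`: no `w` (`j = 0`) or no `v` (`k = 0`)
    rw [Dminus_apply]
    rcases hjk with hj | hk
    · refine pderiv_pderiv_eq_zero_of_notMem_right _ _ (notMem_vars_kkVec ?_)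
      subst hj; simp; split_ifs <;> simp
    · refine pderiv_pderiv_eq_zero_of_notMem_left _ _ (notMem_vars_kkVec ?_)
      subst hk; simp; split_ifs <;> simp

/-! #### Weights of `Δ_{abcd}` (Lemma 5.3 (i), the torus part) -/

/-- transport of a weighted-homogeneity statement along an equality of weights. [folklore] -/
private theorem isWeightedHomogeneous_congr {wt : Var → ℤ} {f : Model} {m n : ℤ} (h : IsWeightedHomogeneous wt f m)
    (e : m = n) : IsWeightedHomogeneous wt f n := e ▸ h

/-- `U(W⁺)`-weight of `kkVec i j k l`: `i − j`. [cite: KonnoKonno2007, Lemma 5.3 (i) p. 74] -/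
theorem isWeightedHomogeneous_colP_kkVec (i j k l : ℕ) :
    IsWeightedHomogeneous colP (kkVec i j k l) ((i : ℤ) - j) := by
  refine isWeightedHomogeneous_congr (((((isWeightedHomogeneous_X _ _ _).pow i).mul
    ((isWeightedHomogeneous_X _ _ _).pow j)).mul ((isWeightedHomogeneous_X _ _ _).pow k)).mul
    ((isWeightedHomogeneous_X _ _ _).pow l)) ?_
  simp [colP]
  ring

/-- `U(W⁻)`-weight of `kkVec i j k l`: `k − l`. [cite: KonnoKonno2007, Lemma 5.3 (i) p. 74] -/
theorem isWeightedHomogeneous_colM_kkVec (i j k l : ℕ) :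
    IsWeightedHomogeneous colM (kkVec i j k l) ((k : ℤ) - l) := by
  refine isWeightedHomogeneous_congr (((((isWeightedHomogeneous_X _ _ _).pow i).mul
    ((isWeightedHomogeneous_X _ _ _).pow j)).mul ((isWeightedHomogeneous_X _ _ _).pow k)).mul
    ((isWeightedHomogeneous_X _ _ _).pow l)) ?_
  simp [colM]
  ring

/-- `U(2)_V`-weight of `kkVec i j k l` on row `0`: `i`. [cite: KonnoKonno2007, Lemma 5.3 (i) p. 74] -/
theorem isWeightedHomogeneous_rowW_zero_kkVec (i j k l : ℕ) :
    IsWeightedHomogeneous (rowW 0) (kkVec i j k l) (i : ℤ) := by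
  refine isWeightedHomogeneous_congr (((((isWeightedHomogeneous_X _ _ _).pow i).mul
    ((isWeightedHomogeneous_X _ _ _).pow j)).mul ((isWeightedHomogeneous_X _ _ _).pow k)).mul
    ((isWeightedHomogeneous_X _ _ _).pow l)) ?_
  simp [rowW]

/-- `U(2)_V`-weight of `kkVec i j k l` on row `1`: `−l` (the entry `y_1` of the conjugate block weighs `−1`).
[cite: KonnoKonno2007, Lemma 5.3 (i) p. 74] -/
theorem isWeightedHomogeneous_rowW_one_kkVec (i j k l : ℕ) :
    IsWeightedHomogeneous (rowW 1) (kkVec i j k l) (-(l : ℤ)) := by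
  refine isWeightedHomogeneous_congr (((((isWeightedHomogeneous_X _ _ _).pow i).mul
    ((isWeightedHomogeneous_X _ _ _).pow j)).mul ((isWeightedHomogeneous_X _ _ _).pow k)).mul
    ((isWeightedHomogeneous_X _ _ _).pow l)) ?_
  simp [rowW]

/-- `U(V⁻)`-weight of `kkVec i j k l`: `k − j`. [cite: KonnoKonno2007, Lemma 5.3 (i) p. 74] -/
theorem isWeightedHomogeneous_uOneV_kkVec (i j k l : ℕ) :
    IsWeightedHomogeneous uOneV (kkVec i j k l) ((k : ℤ) - j) := by
  refine isWeightedHomogeneous_congr (((((isWeightedHomogeneous_X _ _ _).pow i).mul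
    ((isWeightedHomogeneous_X _ _ _).pow j)).mul ((isWeightedHomogeneous_X _ _ _).pow k)).mul
    ((isWeightedHomogeneous_X _ _ _).pow l)) ?_
  simp [uOneV]
  ring

/-! #### The raising operator kills `Δ_{abcd}`; non-vanishing; the assembled Lemma 5.3 (i)–(ii) -/

/-- a derivation killing both factors kills the product. [folklore] -/
private theorem derivation_mul_eq_zero {D : Derivation ℂ Model Model} {f g : Model} (hf : D f = 0) (hg : D g = 0) :
    D (f * g) = 0 := by
  rw [D.leibniz, hf, hg, smul_zero, smul_zero, add_zero]

/-- a derivation killing `f` kills its powers. [folklore] -/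
private theorem derivation_pow_eq_zero {D : Derivation ℂ Model Model} {f : Model} (hf : D f = 0) (n : ℕ) :
    D (f ^ n) = 0 := by
  rw [D.leibniz_pow, hf, smul_zero, smul_zero]

/-- `E_V` kills `kkVec i j k l` (`z_0`, `w`, `v`, `y_1` are all killed by `e_{01}`). [cite: KonnoKonno2007, Lemma 5.3 (i) p. 74] -/
theorem EV_kkVec (i j k l : ℕ) : EV (kkVec i j k l) = 0 :=
  derivation_mul_eq_zero (derivation_mul_eq_zero (derivation_mul_eq_zero
    (derivation_pow_eq_zero (by simp [evGen]) i) (derivation_pow_eq_zero (by simp [evGen]) j))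
    (derivation_pow_eq_zero (by simp [evGen]) k)) (derivation_pow_eq_zero (by simp [evGen]) l)

/-- the all-ones point of the variable space. [folklore] -/
def onesPoint : Var → ℂ := fun _ => 1

/-- `kkVec i j k l` takes the value `1` at the all-ones point. [folklore] -/
private theorem eval_onesPoint_kkVec (i j k l : ℕ) : eval onesPoint (kkVec i j k l) = 1 := by
  simp [kkVec, onesPoint]

/-- `kkVec i j k l ≠ 0` (a highest weight VECTOR). [cite: KonnoKonno2007, Lemma 5.3 (i) p. 74] -/
theorem kkVec_ne_zero (i j k l : ℕ) : kkVec i j k l ≠ 0 := fun h => by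
  have := eval_onesPoint_kkVec i j k l
  rw [h, map_zero] at this
  exact zero_ne_one this

/-- **Lemma 5.3 (i)–(ii) at `U(2,1) × U(1,1)` (tree conventions).**  Under the three constraints of (ii) that are not
vacuous here — `t + u ≤ q = 1` (`j = 0 ∨ k = 0`), `r + t ≤ p′ = 1` (`i = 0 ∨ j = 0`), `s + u ≤ q′ = 1` (`l = 0 ∨ k = 0`) —
the vector `z_0^i w^j v^k y_1^l` is a joint harmonic `K_V × K_W`-highest-weight vector with `U(W⁺)`-weight `i − j`,
`U(W⁻)`-weight `k − l`, `U(2)_V`-weight `(i, −l)` and `U(V⁻)`-weight `k − j` (all relative to the vacuum).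
[cite: KonnoKonno2007, Lemma 5.3 (i)(ii) p. 74] -/
theorem isHWVector_kkVec (i j k l : ℕ) (h : (j = 0 ∨ k = 0) ∧ (i = 0 ∨ j = 0) ∧ (l = 0 ∨ k = 0)) :
    IsHWVector (kkVec i j k l) ((i : ℤ) - j) ((k : ℤ) - l) i (-(l : ℤ)) ((k : ℤ) - j) where
  ne := kkVec_ne_zero i j k l
  harm := isHarmonic_kkVec i j k l h.1 h.2.1 h.2.2
  colP := isWeightedHomogeneous_colP_kkVec i j k l
  colM := isWeightedHomogeneous_colM_kkVec i j k l
  row0 := isWeightedHomogeneous_rowW_zero_kkVec i j k l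
  row1 := isWeightedHomogeneous_rowW_one_kkVec i j k l
  uone := isWeightedHomogeneous_uOneV_kkVec i j k l
  hV := EV_kkVec i j k l

/-- **Sharpness of `t + u ≤ q`**: `w · v` (`t = u = 1`) is not a joint harmonic (`D₋ (w v) = 1`).
[cite: KonnoKonno2007, Lemma 5.3 (ii) p. 74] -/
theorem not_isHarmonic_w_mul_v : ¬ IsHarmonic (w * v) := by
  classical
  intro H
  have h := congrArg (eval onesPoint) H.dminus
  rw [Dminus_apply] at h
  simp [Derivation.leibniz, pderiv_X] at h

/-- **Sharpness of `r + t ≤ p′`**: `z_0 · w` (`r = t = 1`) is not a joint harmonic (`Δ⁺_0 (z_0 w) = 1`).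
[cite: KonnoKonno2007, Lemma 5.3 (ii) p. 74] -/
theorem not_isHarmonic_z_mul_w : ¬ IsHarmonic (z 0 * w) := by
  classical
  intro H
  have h := congrArg (eval onesPoint) (H.deltaP 0)
  rw [DeltaP_apply] at h
  simp [Derivation.leibniz, pderiv_X] at h

/-- **Sharpness of `s + u ≤ q′`**: `y_1 · v` (`s = u = 1`) is not a joint harmonic (`Δ⁻_1 (y_1 v) = 1`).
[cite: KonnoKonno2007, Lemma 5.3 (ii) p. 74] -/
theorem not_isHarmonic_y_mul_v : ¬ IsHarmonic (y 1 * v) := by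
  classical
  intro H
  have h := congrArg (eval onesPoint) (H.deltaM 1)
  rw [DeltaM_apply] at h
  simp [Derivation.leibniz, pderiv_X] at h

/-! ### B.4 Ichino's Lemma 7.10 over the model: the dictionary, the PROVED half, and the reduction to Lemma 5.3 (iii) -/

section Dictionary

open FockHarmonics HarmonicParam

/-- **The joint-harmonics correspondence of the explicit model `ℂ[z_a, w, y_a, v]`**, as an instance of Ichino's
dictionary for a datum `S` of signature `(p,q;r,s) = (1,1;2,1)` (`U(W) = U(1,1)`, `U(V) = U(2,1)`): `μ ⊠ μ′` occurs in the
joint harmonics iff some joint harmonic `K_V × K_W`-highest-weight vector has polynomial weights which, SHIFTED by the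
printed vacuum weights `((r−s)/2; (s−r)/2) + m₀/2` (on `K = U(W⁺) × U(W⁻)`) and `((p−q)/2; (q−p)/2) + n₀/2` (on
`K′ = U(2)_V × U(V⁻)`), are `(μ; μ′)`. [cite: Ichino2022ThetaReal, §7.5 Lemma 7.10; KonnoKonno2007, Thm 5.4 p. 75] -/
def explicitMixedPlane (S : SplittingDatum) (hp : S.p = 1) (hq : S.q = 1) (hr : S.r = 2) (hs : S.s = 1) :
    FockHarmonics S where
  corresponds μ μ' := ∃ (f : Model) (kP kM n₀ n₁ nv : ℤ), IsHWVector f kP kM n₀ n₁ nv ∧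
    μ.1 ⟨0, by omega⟩ = (kP : ℚ) + ((S.r : ℚ) - S.s) / 2 + (S.m₀ : ℚ) / 2 ∧
    μ.2 ⟨0, by omega⟩ = (kM : ℚ) + ((S.s : ℚ) - S.r) / 2 + (S.m₀ : ℚ) / 2 ∧
    μ'.1 ⟨0, by omega⟩ = (n₀ : ℚ) + ((S.p : ℚ) - S.q) / 2 + (S.n₀ : ℚ) / 2 ∧
    μ'.1 ⟨1, by omega⟩ = (n₁ : ℚ) + ((S.p : ℚ) - S.q) / 2 + (S.n₀ : ℚ) / 2 ∧
    μ'.2 ⟨0, by omega⟩ = (nv : ℚ) + ((S.q : ℚ) - S.p) / 2 + (S.n₀ : ℚ) / 2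

variable (S : SplittingDatum) (hp : S.p = 1) (hq : S.q = 1) (hr : S.r = 2) (hs : S.s = 1)

/-- **The PROVED half of Lemma 7.10 / Thm 5.4 (ii) at `(1,1;2,1)`**: every printed parameter `P` (strings of length `≤ 1`,
`p⁺ + p⁻ ≤ 1`, `q⁺ + q⁻ ≤ 1`, `p⁻ + q⁺ ≤ 1`) is realised — `P.mu ⊠ P.mu′` occurs in the joint harmonics of the model,
through `Δ_{abcd} = kkVec a₁ (−b₁) c₁ (−d₁)` (absent strings read as exponent `0`).
[cite: Ichino2022ThetaReal, §7.5 Lemma 7.10; KonnoKonno2007, Lemma 5.3 (i)(ii) p. 74] -/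
theorem corresponds_mu_mu' (P : HarmonicParam S) : (explicitMixedPlane S hp hq hr hs).corresponds P.mu P.mu' := by
  have h1 : P.pp + P.pm ≤ 1 := hp ▸ P.hp
  have h2 : P.qp + P.qm ≤ 1 := hq ▸ P.hq
  have h3 : P.pm + P.qp ≤ 1 := hs ▸ P.hs
  -- the four non-negative integers read off the parameter
  have hI : 0 ≤ headD P.a := by
    unfold headD; split_ifs with h
    · exact (P.a_pos _).le
    · exact le_rfl
  have hJ : headD P.b ≤ 0 := by
    unfold headD; split_ifs with h
    · exact (P.b_neg _).le
    · exact le_rfl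
  have hK : 0 ≤ headD P.c := by
    unfold headD; split_ifs with h
    · exact (P.c_pos _).le
    · exact le_rfl
  have hL : headD P.d ≤ 0 := by
    unfold headD; split_ifs with h
    · exact (P.d_neg _).le
    · exact le_rfl
  have hIJ : headD P.a = 0 ∨ headD P.b = 0 := by
    by_cases h : 0 < P.pp
    · exact Or.inr (headD_of_not _ (by omega))
    · exact Or.inl (headD_of_not _ h)
  have hLK : headD P.d = 0 ∨ headD P.c = 0 := by
    by_cases h : 0 < P.qm
    · exact Or.inr (headD_of_not _ (by omega))
    · exact Or.inl (headD_of_not _ h)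
  have hJK : headD P.b = 0 ∨ headD P.c = 0 := by
    by_cases h : 0 < P.pm
    · exact Or.inr (headD_of_not _ (by omega))
    · exact Or.inl (headD_of_not _ h)
  obtain ⟨i, hi⟩ : ∃ i : ℕ, (i : ℤ) = headD P.a := ⟨_, Int.toNat_of_nonneg hI⟩
  obtain ⟨j, hj⟩ : ∃ j : ℕ, (j : ℤ) = -headD P.b := ⟨_, Int.toNat_of_nonneg (by omega)⟩
  obtain ⟨k, hk⟩ : ∃ k : ℕ, (k : ℤ) = headD P.c := ⟨_, Int.toNat_of_nonneg hK⟩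
  obtain ⟨l, hl⟩ : ∃ l : ℕ, (l : ℤ) = -headD P.d := ⟨_, Int.toNat_of_nonneg (by omega)⟩
  have hi' : (i : ℚ) = headD P.a := by exact_mod_cast hi
  have hj' : (j : ℚ) = -(headD P.b : ℚ) := by exact_mod_cast hj
  have hk' : (k : ℚ) = headD P.c := by exact_mod_cast hk
  have hl' : (l : ℚ) = -(headD P.d : ℚ) := by exact_mod_cast hl
  refine ⟨_, _, _, _, _, _, isHWVector_kkVec i j k l ⟨by omega, by omega, by omega⟩, ?_, ?_, ?_, ?_, ?_⟩
  · rw [mu_fst_apply, pad_eq_headD_of_eq_one hp]; push_cast; linarith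
  · rw [mu_snd_apply, pad_eq_headD_of_eq_one hq]; push_cast; linarith
  · rw [mu'_fst_apply, pad_fst_eq_headD_of_eq_two hr _ (by omega) (by omega)]; push_cast; linarith
  · rw [mu'_fst_apply, pad_snd_eq_headD_of_eq_two hr _ (by omega) (by omega)]; push_cast; linarith
  · rw [mu'_snd_apply, pad_eq_headD_of_eq_one hs]; push_cast; linarith

/-- The parameter of Lemma 7.10 at `(1,1;2,1)` with strings `a = (i)`, `b = (−j)`, `c = (k)`, `d = (−l)`, a string being
EMPTY when its exponent is `0` (lengths `min · 1`). [cite: Ichino2022ThetaReal, §7.5 Lemma 7.10] -/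
def mixedParam (i j k l : ℕ) (hij : i = 0 ∨ j = 0) (hlk : l = 0 ∨ k = 0) (hjk : j = 0 ∨ k = 0) :
    HarmonicParam S where
  pp := min i 1
  pm := min j 1
  qp := min k 1
  qm := min l 1
  a := fun _ => i
  b := fun _ => -(j : ℤ)
  c := fun _ => k
  d := fun _ => -(l : ℤ)
  a_anti := fun _ _ _ => le_rfl
  b_anti := fun _ _ _ => le_rfl
  c_anti := fun _ _ _ => le_rfl
  d_anti := fun _ _ _ => le_rfl
  a_pos := fun idx => by have := idx.isLt; omega
  b_neg := fun idx => by have := idx.isLt; omega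
  c_pos := fun idx => by have := idx.isLt; omega
  d_neg := fun idx => by have := idx.isLt; omega
  hp := by omega
  hq := by omega
  hr := by omega
  hs := by omega

/-- **Reduction of Lemma 7.10 / Thm 5.4 at `(1,1;2,1)` to Lemma 5.3 (iii).**  If every joint harmonic
`K_V × K_W`-highest-weight vector of the model has the WEIGHTS of some admissible `Δ_{abcd}` — `U(W⁺)`: `i−j`, `U(W⁻)`:
`k−l`, `U(2)_V`: `(i, −l)`, `U(V⁻)`: `k−j` with `(j = 0 ∨ k = 0) ∧ (i = 0 ∨ j = 0) ∧ (l = 0 ∨ k = 0)` — (Konno–Konno: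
"*Any `b̄_V ⊕ b_W`-highest weight vector in … `J_{V,W,ξ}` is of the form `Δ_{abcd}`*", to be supplied by the closing seat)
then Ichino's Lemma 7.10 HOLDS for the model, for every choice of the splitting exponents `(m₀, n₀)`.
[cite: KonnoKonno2007, Lemma 5.3 (iii) p. 74, Thm 5.4 p. 75; Ichino2022ThetaReal, §7.5 Lemma 7.10] -/
theorem lemma_7_10_of_classification
    (H : ∀ (f : Model) (kP kM n₀ n₁ nv : ℤ), IsHWVector f kP kM n₀ n₁ nv →
      ∃ i j k l : ℕ, ((j = 0 ∨ k = 0) ∧ (i = 0 ∨ j = 0) ∧ (l = 0 ∨ k = 0)) ∧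
        kP = (i : ℤ) - j ∧ kM = (k : ℤ) - l ∧ n₀ = (i : ℤ) ∧ n₁ = -(l : ℤ) ∧ nv = (k : ℤ) - j) :
    (explicitMixedPlane S hp hq hr hs).Lemma_7_10 := by
  intro μ μ'
  constructor
  · rintro ⟨f, kP, kM, n₀, n₁, nv, hf, e0, e1, e2, e3, e4⟩
    obtain ⟨i, j, k, l, ⟨hjk, hij, hlk⟩, rfl, rfl, rfl, rfl, rfl⟩ := H f kP kM n₀ n₁ nv hf
    refine ⟨mixedParam S hp hq hr hs i j k l hij hlk hjk, ?_, ?_⟩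
    · ext idx
      · obtain rfl : idx = ⟨0, by omega⟩ := Fin.ext (by have := idx.isLt; omega)
        rw [e0, mu_fst_apply, pad_eq_headD_of_eq_one hp]
        simp only [mixedParam]
        rw [headD_const_min i (i : ℤ) (fun h => by simp [h]), headD_const_min j (-(j : ℤ)) (fun h => by simp [h])]
        push_cast; ring
      · obtain rfl : idx = ⟨0, by omega⟩ := Fin.ext (by have := idx.isLt; omega)
        rw [e1, mu_snd_apply, pad_eq_headD_of_eq_one hq]
        simp only [mixedParam]
        rw [headD_const_min k (k : ℤ) (fun h => by simp [h]), headD_const_min l (-(l : ℤ)) (fun h => by simp [h])]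
        push_cast; ring
    · ext idx
      · have hidx : idx = ⟨0, by omega⟩ ∨ idx = ⟨1, by omega⟩ := by
          have := idx.isLt
          rcases Nat.lt_or_ge idx.val 1 with h | h
          · exact Or.inl (Fin.ext (by simp; omega))
          · exact Or.inr (Fin.ext (by simp; omega))
        rcases hidx with rfl | rfl
        · rw [e2, mu'_fst_apply, pad_fst_eq_headD_of_eq_two hr _ (by simp [mixedParam]) (by simp [mixedParam])]
          simp only [mixedParam]
          rw [headD_const_min i (i : ℤ) (fun h => by simp [h])]
        · rw [e3, mu'_fst_apply, pad_snd_eq_headD_of_eq_two hr _ (by simp [mixedParam]) (by simp [mixedParam])]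
          simp only [mixedParam]
          rw [headD_const_min l (-(l : ℤ)) (fun h => by simp [h])]
      · obtain rfl : idx = ⟨0, by omega⟩ := Fin.ext (by have := idx.isLt; omega)
        rw [e4, mu'_snd_apply, pad_eq_headD_of_eq_one hs]
        simp only [mixedParam]
        rw [headD_const_min k (k : ℤ) (fun h => by simp [h]), headD_const_min j (-(j : ℤ)) (fun h => by simp [h])]
        push_cast; ring
  · rintro ⟨P, rfl, rfl⟩
    exact corresponds_mu_mu' S hp hq hr hs P

end Dictionary

end MixedPlane

end

end Literature.RepresentationTheory.KonnoKonno2007
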